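import Mathlib.LinearAlgebra.Matrix.Determinant.Basic
import Mathlib.Logic.Equiv.Prod
import Mathlib.Data.Fintype.Perm
import Mathlib.Algebra.CharZero.Infinite
import Literature.Computability.AlgebraicComplexity.OrbitClosureWeights
import HarnessLib

/-!
# Cayley's first hyperdeterminant and the highest-weight vector of an even rectangle
# (BIP 2019, Cor. 4.8 / Prop. 2.3, dual form)

Bürgisser–Ikenmeyer–Panova, J. AMS 32 (2019) = arXiv:1604.06431v3, Prop. 2.3: "Let `n ≥ kℓ` and
`ℓ` be even. Then `(k × ℓ)♯nk` occurs in `ℂ[Ω_n]_k`", proved in §6(b) from the highest-weight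
vector `v_T ∈ Sym^k Sym^ℓ V` of the tableau of shape `k × ℓ` with content `k × ℓ` and Cor. 4.8
(`⟨v_T, (a X_1^ℓ + b X_2^ℓ + ⋯ + b X_k^ℓ)^k⟩ ≠ 0` for `ℓ` even), via the tableau calculus of §4.

This file replaces the tableau calculus by **Cayley's first hyperdeterminant** `Det` of an
`ℓ`-dimensional `k × ⋯ × k` array (the full contraction with `ℓ` Levi-Civita tensors), which is,
in the dual coordinate-ring convention of the tree, the polynomial function `q ↦ ⟨v_T, q^{⊗k}⟩` up to
a nonzero constant:

* §1 `hyperdet`, its determinant expansion along a slot (`hyperdet_eq_sum_det`), the resulting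
  relative invariance `Det(M ⋆_r A) = det(M) Det(A)` in each slot (`hyperdet_slotMul`) and for the
  diagonal action `Det((M,…,M)·A) = det(M)^ℓ Det(A)` (`hyperdet_tensorMul`), and its value
  `Det(diag(c)) = k! ∏ c_i` on diagonal arrays for `ℓ` even (`hyperdet_diagArr`; for odd `ℓ` the
  hyperdeterminant vanishes identically);
* §2 words `J : Fin ℓ → σ`, their contents `wordExp J`, and the **symmetric array**
  `arrOf ℓ q` of a form of degree `ℓ` (`A(q)_J = coeff_{x_J}(q) / #{I : x_I = x_J}`, characteristic
  zero), with the symmetrisation identity `q = ∑_J A(q)_J x_J` (`sum_arrOf_mul_prod_X`) and the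
  **tensor transformation law** `A(B·q)_I = ∑_J (∏_r B_{I_r J_r}) A(q)_J` under linear substitution
  (`arrOf_linSubst`), which for upper triangular `B` does not mix lower letters into words on an
  upper set of letters (`arrOf_linSubst_comp_of_upper`);
* §3 the **hyperdeterminant polynomial** `hyperdetPoly ℓ t ∈ k[Sym^ℓ]` on `kk` letters `t`
  (a form of degree `kk`, `isHomogeneous_hyperdetPoly`), its values
  (`aeval_formCoeff_hyperdetPoly`), its relative invariance under upper triangular substitutions
  (`aeval_formCoeff_linSubst_hyperdetPoly`), whence — polynomial functions on `Sym^ℓ V^*` being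
  determined by their values — it is a **highest-weight vector** of `k[Sym^ℓ]` of weight
  `rectWeight ℓ t` (`-ℓ` on the letters; `hyperdetPoly_mem_highestWeightSpace`), and its value
  `kk! ∏ c` at rescaled power sums of the letters (`aeval_hyperdetPoly_scaled_powerSum`).

The assembly of Prop. 2.3 (lifting by `innerLift`, padded power sums in `Ω_m` by Thm. 2.5) is in
`OccurrenceObstructionsBIP.lean` §7 (`bip2019_prop_2_3_holds`).

## References

* P. Bürgisser, C. Ikenmeyer, G. Panova, J. AMS 32 (2019) = arXiv:1604.06431v3, Prop. 2.3,
  Cor. 4.8, §6(b) (key `BurgisserIkenmeyerPanovaJAMS2019`).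
* A. Cayley, *On the theory of determinants*, Trans. Cambridge Phil. Soc. 8 (1843);
  I. M. Gelfand, M. M. Kapranov, A. V. Zelevinsky, *Discriminants, Resultants and Multidimensional
  Determinants*, Birkhäuser (1994), Ch. 14, §1 (the combinatorial hyperdeterminant; folklore here).
-/

open MvPolynomial

namespace Literature.Computability.AlgebraicComplexity


section HyperdetCore

variable {R : Type*} [CommRing R] {ℓ kk : ℕ}

/-- **Cayley's first hyperdeterminant** (the full contraction with `ℓ` Levi-Civita tensors) of an
`ℓ`-dimensional array `A : (Fin ℓ → Fin kk) → R` of format `kk × ⋯ × kk`: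
`Det(A) = ∑_{σ_0,…,σ_{ℓ-1} ∈ S_k} (∏_j sgn σ_j) ∏_{i<k} A(σ_0(i), …, σ_{ℓ-1}(i))` (each geometric term
counted `kk!` times; identically `0` for odd `ℓ`). Invariant under `SL_k` in every slot
(`hyperdet_slotMul`). Cayley (1843); Gelfand–Kapranov–Zelevinsky, *Discriminants, Resultants and
Multidimensional Determinants*, Ch. 14, §1 (the combinatorial hyperdeterminant); the invariant behind
BIP Cor. 4.8 / Prop. 2.3 (even rectangles occur). [folklore] -/
def hyperdet (A : (Fin ℓ → Fin kk) → R) : R :=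
  ∑ σ : Fin ℓ → Equiv.Perm (Fin kk), (∏ j, (Equiv.Perm.sign (σ j) : R)) * ∏ i, A fun j => σ j i

/-- The action of a `kk × kk` matrix `M` in slot `r` of an array:
`(M ⋆_r A)(I) = ∑_a M_{I_r a} A(I[r ↦ a])`. [folklore] -/
def slotMul (r : Fin ℓ) (M : Matrix (Fin kk) (Fin kk) R) (A : (Fin ℓ → Fin kk) → R) :
    (Fin ℓ → Fin kk) → R :=
  fun I => ∑ a, M (I r) a * A (Function.update I r a)

/-- The tuple with slot `r` set to `a` and the other slots read off `σ' : {j ≠ r} → S_k` at `i`.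
[folklore] -/
def fillSlot (r : Fin ℓ) (σ' : {j : Fin ℓ // j ≠ r} → Equiv.Perm (Fin kk)) (a i : Fin kk) :
    Fin ℓ → Fin kk :=
  fun j => if h : j = r then a else σ' ⟨j, h⟩ i

/-- Updating slot `r` of `fillSlot r σ' a i` replaces `a`. [folklore] -/
theorem update_fillSlot (r : Fin ℓ) (σ' : {j : Fin ℓ // j ≠ r} → Equiv.Perm (Fin kk)) (a i c : Fin kk) :
    Function.update (fillSlot r σ' a i) r c = fillSlot r σ' c i := by
  funext j
  by_cases h : j = r
  · subst h; simp [fillSlot]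
  · simp [fillSlot, h]

/-- The `kk × kk` matrix of an array along slot `r`, the other slots frozen along `σ'`:
`N_{a i} = A(r ↦ a, j ↦ σ'_j(i))`. [folklore] -/
def slotMatrix (r : Fin ℓ) (σ' : {j : Fin ℓ // j ≠ r} → Equiv.Perm (Fin kk))
    (A : (Fin ℓ → Fin kk) → R) : Matrix (Fin kk) (Fin kk) R :=
  Matrix.of fun a i => A (fillSlot r σ' a i)

/-- **Determinant expansion of the hyperdeterminant along a slot**:
`Det(A) = ∑_{σ'} (∏_{j ≠ r} sgn σ'_j) det(N_{r,σ'})`. [folklore] -/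
theorem hyperdet_eq_sum_det (r : Fin ℓ) (A : (Fin ℓ → Fin kk) → R) :
    hyperdet A = ∑ σ' : {j : Fin ℓ // j ≠ r} → Equiv.Perm (Fin kk),
      (∏ j, (Equiv.Perm.sign (σ' j) : R)) * (slotMatrix r σ' A).det := by
  classical
  unfold hyperdet
  rw [← (Equiv.funSplitAt r (Equiv.Perm (Fin kk))).symm.sum_comp, Fintype.sum_prod_type,
    Finset.sum_comm]
  refine Finset.sum_congr rfl fun σ' _ => ?_
  rw [Matrix.det_apply', Finset.mul_sum]
  refine Finset.sum_congr rfl fun τ _ => ?_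
  -- the sign: `∏_j sgn = sgn τ · ∏_{j ≠ r} sgn σ'_j`
  have hsign : (∏ j, (Equiv.Perm.sign ((Equiv.funSplitAt r (Equiv.Perm (Fin kk))).symm (τ, σ') j) : R)) =
      (Equiv.Perm.sign τ : R) * ∏ j, (Equiv.Perm.sign (σ' j) : R) := by
    rw [← Finset.mul_prod_erase Finset.univ _ (Finset.mem_univ r),
      Finset.prod_subtype (p := fun j => j ≠ r) (Finset.univ.erase r) (fun j => by simp)]
    congr 1
    · simp [Equiv.funSplitAt_symm_apply]
    · refine Finset.prod_congr rfl fun j _ => ?_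
      simp [Equiv.funSplitAt_symm_apply, j.2]
  have hprod : (∏ i, A fun j => ((Equiv.funSplitAt r (Equiv.Perm (Fin kk))).symm (τ, σ') j) i) =
      ∏ i, slotMatrix r σ' A (τ i) i := by
    refine Finset.prod_congr rfl fun i _ => ?_
    rw [slotMatrix, Matrix.of_apply]
    congr 1
    funext j
    by_cases h : j = r
    · subst h; simp [fillSlot, Equiv.funSplitAt_symm_apply]
    · simp [fillSlot, Equiv.funSplitAt_symm_apply, h]
  rw [hsign, hprod]
  ring

/-- Along slot `r`, the slot action multiplies the slot matrices: `N_{r,σ'}(M ⋆_r A) = M · N_{r,σ'}(A)`.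
[folklore] -/
theorem slotMatrix_slotMul (r : Fin ℓ) (σ' : {j : Fin ℓ // j ≠ r} → Equiv.Perm (Fin kk))
    (M : Matrix (Fin kk) (Fin kk) R) (A : (Fin ℓ → Fin kk) → R) :
    slotMatrix r σ' (slotMul r M A) = M * slotMatrix r σ' A := by
  ext a i
  simp only [slotMatrix, Matrix.of_apply, slotMul, Matrix.mul_apply, update_fillSlot]
  refine Finset.sum_congr rfl fun c _ => ?_
  simp [fillSlot]

/-- **`SL_k`-invariance of the hyperdeterminant in each slot**: `Det(M ⋆_r A) = det(M) · Det(A)`.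
Gelfand–Kapranov–Zelevinsky Ch. 14, Prop. 1.4. [folklore] -/
theorem hyperdet_slotMul (r : Fin ℓ) (M : Matrix (Fin kk) (Fin kk) R) (A : (Fin ℓ → Fin kk) → R) :
    hyperdet (slotMul r M A) = M.det * hyperdet A := by
  rw [hyperdet_eq_sum_det r, hyperdet_eq_sum_det r, Finset.mul_sum]
  refine Finset.sum_congr rfl fun σ' _ => ?_
  rw [slotMatrix_slotMul, Matrix.det_mul]
  ring

/-- The action of `M` in a set `S` of slots, written with an indicator over all tuples:
`(M ⋆_S A)(I) = ∑_{J = I off S} (∏_{r ∈ S} M_{I_r J_r}) A(J)`. [folklore] -/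
def slotsMul (S : Finset (Fin ℓ)) (M : Matrix (Fin kk) (Fin kk) R) (A : (Fin ℓ → Fin kk) → R) :
    (Fin ℓ → Fin kk) → R :=
  fun I => ∑ J : Fin ℓ → Fin kk,
    (if ∀ j, j ∉ S → J j = I j then ∏ r ∈ S, M (I r) (J r) else 0) * A J

/-- No slot: the identity. [folklore] -/
theorem slotsMul_empty (M : Matrix (Fin kk) (Fin kk) R) (A : (Fin ℓ → Fin kk) → R) :
    slotsMul ∅ M A = A := by
  classical
  funext I
  rw [slotsMul, Finset.sum_eq_single I]
  · simp
  · intro J _ hJ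
    rw [if_neg, zero_mul]
    intro h
    exact hJ (funext fun j => h j (Finset.notMem_empty j))
  · exact fun h => absurd (Finset.mem_univ I) h

/-- Adding a slot: `M ⋆_{insert r S} = (M ⋆_r) ∘ (M ⋆_S)` for `r ∉ S`. [folklore] -/
theorem slotMul_slotsMul {S : Finset (Fin ℓ)} {r : Fin ℓ} (hr : r ∉ S) (M : Matrix (Fin kk) (Fin kk) R)
    (A : (Fin ℓ → Fin kk) → R) : slotMul r M (slotsMul S M A) = slotsMul (insert r S) M A := by
  classical
  funext I
  simp only [slotMul, slotsMul, Finset.mul_sum]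
  rw [Finset.sum_comm]
  refine Finset.sum_congr rfl fun J _ => ?_
  -- group the `a`-sum: only `a = J r` can contribute
  rw [Finset.sum_eq_single (J r)]
  · by_cases hJ : ∀ j, j ∉ insert r S → J j = I j
    · have hJ' : ∀ j, j ∉ S → J j = Function.update I r (J r) j := by
        intro j hj
        by_cases hjr : j = r
        · subst hjr; simp
        · rw [Function.update_of_ne hjr]
          exact hJ j (by simp [hjr, hj])
      rw [if_pos hJ', if_pos hJ, Finset.prod_insert hr]
      have : ∏ x ∈ S, M (Function.update I r (J r) x) (J x) = ∏ x ∈ S, M (I x) (J x) :=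
        Finset.prod_congr rfl fun x hx => by
          have hxr : x ≠ r := fun h => hr (h ▸ hx)
          have hx' : Function.update I r (J r) x = I x := Function.update_of_ne hxr ..
          simp only [hx']
      rw [this]
      ring
    · rw [if_neg hJ, zero_mul]
      by_cases hJ' : ∀ j, j ∉ S → J j = Function.update I r (J r) j
      · exfalso
        apply hJ
        intro j hj
        rw [Finset.mem_insert, not_or] at hj
        have := hJ' j hj.2
        rwa [Function.update_of_ne hj.1] at this
      · rw [if_neg hJ']
        simp
  · intro a _ ha
    rw [if_neg]
    · simp
    · intro h
      have := h r hr
      rw [Function.update_self] at this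
      exact ha this.symm
  · exact fun h => absurd (Finset.mem_univ _) h

/-- All slots: `M ⋆_{univ} A (I) = ∑_J (∏_r M_{I_r J_r}) A(J)`, the natural action of `M` on
`ℓ`-tensors. [folklore] -/
theorem slotsMul_univ (M : Matrix (Fin kk) (Fin kk) R) (A : (Fin ℓ → Fin kk) → R) (I : Fin ℓ → Fin kk) :
    slotsMul Finset.univ M A I = ∑ J : Fin ℓ → Fin kk, (∏ r, M (I r) (J r)) * A J := by
  rw [slotsMul]
  refine Finset.sum_congr rfl fun J _ => ?_
  rw [if_pos fun j hj => absurd (Finset.mem_univ j) hj]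

/-- **Multiplicativity**: `Det(M ⋆_S A) = det(M)^{|S|} Det(A)`. [folklore] -/
theorem hyperdet_slotsMul (S : Finset (Fin ℓ)) (M : Matrix (Fin kk) (Fin kk) R)
    (A : (Fin ℓ → Fin kk) → R) : hyperdet (slotsMul S M A) = M.det ^ S.card * hyperdet A := by
  classical
  induction S using Finset.induction_on with
  | empty => rw [slotsMul_empty, Finset.card_empty, pow_zero, one_mul]
  | insert r S hr ih =>
    rw [← slotMul_slotsMul hr, hyperdet_slotMul, ih, Finset.card_insert_of_notMem hr, pow_succ]
    ring

/-- **`Det((M, …, M) · A) = det(M)^ℓ Det(A)`**: the hyperdeterminant is a relative invariant of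
weight `det^ℓ` for the diagonal action of `GL_k` on `ℓ`-tensors. Gelfand–Kapranov–Zelevinsky
Ch. 14, Prop. 1.4. [folklore] -/
theorem hyperdet_tensorMul (M : Matrix (Fin kk) (Fin kk) R) (A : (Fin ℓ → Fin kk) → R) :
    hyperdet (fun I => ∑ J : Fin ℓ → Fin kk, (∏ r, M (I r) (J r)) * A J) = M.det ^ ℓ * hyperdet A := by
  have h := hyperdet_slotsMul Finset.univ M A
  rw [Finset.card_univ, Fintype.card_fin] at h
  rw [← h]
  congr 1
  funext I
  rw [slotsMul_univ]

/-! ### The hyperdeterminant of a diagonal array -/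

/-- The diagonal array with entries `c`: `A(I) = c_i` if `I ≡ i` is constant, `0` otherwise
(for `ℓ ≥ 1`; written as a sum of indicators). [folklore] -/
def diagArr (c : Fin kk → R) (I : Fin ℓ → Fin kk) : R :=
  ∑ i, if ∀ j, I j = i then c i else 0

/-- On a constant tuple the diagonal array returns the entry (`ℓ ≥ 1`). [folklore] -/
theorem diagArr_const (hℓ : 0 < ℓ) (c : Fin kk → R) (i : Fin kk) :
    diagArr c (fun _ : Fin ℓ => i) = c i := by
  classical
  rw [diagArr, Finset.sum_eq_single i]
  · rw [if_pos fun _ => rfl]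
  · intro i' _ hi'
    rw [if_neg]
    intro h
    exact hi' (h ⟨0, hℓ⟩).symm
  · exact fun h => absurd (Finset.mem_univ i) h

/-- Off the constant tuples the diagonal array vanishes. [folklore] -/
theorem diagArr_of_ne (c : Fin kk → R) {I : Fin ℓ → Fin kk} {j j' : Fin ℓ} (h : I j ≠ I j') :
    diagArr c I = 0 := by
  rw [diagArr]
  refine Finset.sum_eq_zero fun i _ => if_neg ?_
  intro hi
  exact h ((hi j).trans (hi j').symm)

/-- The sign character is `±1`: `sgn(τ)^ℓ = 1` for even `ℓ`. [folklore] -/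
theorem sign_pow_even_cast {n : Type*} [Fintype n] [DecidableEq n] (τ : Equiv.Perm n) {ℓ : ℕ}
    (he : Even ℓ) : ((Equiv.Perm.sign τ : ℤˣ) : R) ^ ℓ = 1 := by
  obtain ⟨t, rfl⟩ := he
  have hx : (((Equiv.Perm.sign τ : ℤˣ) : ℤ) : R) * (((Equiv.Perm.sign τ : ℤˣ) : ℤ) : R) = 1 := by
    rw [← Int.cast_mul, ← Units.val_mul, Int.units_mul_self, Units.val_one, Int.cast_one]
  rw [← two_mul, pow_mul, sq]
  change ((((Equiv.Perm.sign τ : ℤˣ) : ℤ) : R) * (((Equiv.Perm.sign τ : ℤˣ) : ℤ) : R)) ^ t = 1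
  rw [hx, one_pow]

/-- **The hyperdeterminant of a diagonal array** (`ℓ ≥ 1` slots, `ℓ` even):
`Det(diag(c)) = k! · ∏_i c_i` — only the tuples of equal permutations contribute, each with sign
`sgn(τ)^ℓ = 1`. This is the computation behind BIP Cor. 4.8 ("`⟨v_T, (X_1^ℓ + ⋯ + X_k^ℓ)^k⟩ ≠ 0`
for `ℓ` even"). [folklore] -/
theorem hyperdet_diagArr (hℓ : 0 < ℓ) (he : Even ℓ) (c : Fin kk → R) :
    hyperdet (diagArr (ℓ := ℓ) c) = (Nat.factorial kk : R) * ∏ i, c i := by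
  classical
  unfold hyperdet
  -- only constant `σ` (all `σ_j` equal) contribute
  have hzero : ∀ σ : Fin ℓ → Equiv.Perm (Fin kk), ¬(∀ j, σ j = σ ⟨0, hℓ⟩) →
      (∏ j, (Equiv.Perm.sign (σ j) : R)) * ∏ i, diagArr c (fun j => σ j i) = 0 := by
    intro σ hσ
    obtain ⟨j, hj⟩ := not_forall.mp hσ
    obtain ⟨i, hi⟩ : ∃ i, σ j i ≠ σ ⟨0, hℓ⟩ i := by
      by_contra hcon
      push Not at hcon
      exact hj (Equiv.ext hcon)
    rw [Finset.prod_eq_zero (Finset.mem_univ i) (diagArr_of_ne c (j := j) (j' := ⟨0, hℓ⟩) hi),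
      mul_zero]
  rw [← Finset.sum_filter_of_ne fun σ _ hne => by
    by_contra hσ
    exact hne (hzero σ hσ)]
  -- the constant tuples are parametrised by `S_k`
  have himage : (Finset.univ : Finset (Fin ℓ → Equiv.Perm (Fin kk))).filter
      (fun σ => ∀ j, σ j = σ ⟨0, hℓ⟩) =
      (Finset.univ : Finset (Equiv.Perm (Fin kk))).map
        ⟨fun τ => fun _ => τ, fun τ τ' h => congrFun h ⟨0, hℓ⟩⟩ := by
    ext σ
    simp only [Finset.mem_filter, Finset.mem_univ, true_and, Finset.mem_map,
      Function.Embedding.coeFn_mk]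
    constructor
    · intro h
      exact ⟨σ ⟨0, hℓ⟩, funext fun j => (h j).symm⟩
    · rintro ⟨τ, rfl⟩ j
      rfl
  rw [himage, Finset.sum_map]
  simp only [Function.Embedding.coeFn_mk, Finset.prod_const, Finset.card_univ, Fintype.card_fin,
    sign_pow_even_cast _ he, one_mul, diagArr_const hℓ]
  rw [Finset.sum_congr rfl fun (τ : Equiv.Perm (Fin kk)) _ => Equiv.prod_comp τ c, Finset.sum_const,
    Finset.card_univ, Fintype.card_perm, Fintype.card_fin, nsmul_eq_mul]


end HyperdetCore


variable {k : Type*} [Field k] {σ : Type*} {ℓ : ℕ}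

/-- The exponent vector (content) of a word `J : Fin ℓ → σ`: `∑_j ε_{J j}`, of degree `ℓ`.
[folklore] -/
noncomputable def wordExp (J : Fin ℓ → σ) : σ →₀ ℕ :=
  ∑ j, Finsupp.single (J j) 1

omit [Field k] in
/-- The exponent vector of a word of length `ℓ` has degree `ℓ`. [folklore] -/
theorem degree_wordExp (J : Fin ℓ → σ) : (wordExp J).degree = ℓ := by
  rw [wordExp, map_sum]
  simp

section Words

variable [DecidableEq σ]

omit [Field k] in
/-- The exponent vector counts letters: `(wordExp J) x = #{j | J j = x}`. [folklore] -/
theorem wordExp_apply (J : Fin ℓ → σ) (x : σ) :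
    wordExp J x = (Finset.univ.filter fun j => J j = x).card := by
  rw [wordExp, Finsupp.coe_finsetSum, Finset.sum_apply]
  simp only [Finsupp.single_apply]
  rw [Finset.card_eq_sum_ones, Finset.sum_filter]

omit [Field k] in
/-- Words are permutations of each other iff they have the same exponent vector
(`Equiv.ofFiberEquiv` fibrewise). [folklore] -/
theorem exists_comp_perm_eq_of_wordExp_eq {I J : Fin ℓ → σ} (h : wordExp I = wordExp J) :
    ∃ π : Equiv.Perm (Fin ℓ), I ∘ π = J := by
  classical
  have hc : ∀ x, (Finset.univ.filter fun j => I j = x).card =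
      (Finset.univ.filter fun j => J j = x).card := fun x => by
    rw [← wordExp_apply, ← wordExp_apply, h]
  have e : ∀ x, {j // J j = x} ≃ {j // I j = x} := fun x =>
    Fintype.equivOfCardEq (by rw [Fintype.card_subtype, Fintype.card_subtype, hc x])
  exact ⟨Equiv.ofFiberEquiv e, funext (Equiv.ofFiberEquiv_map e)⟩

omit [Field k] [DecidableEq σ] in
/-- Permuting a word does not change its exponent vector. [folklore] -/
theorem wordExp_comp_perm (J : Fin ℓ → σ) (π : Equiv.Perm (Fin ℓ)) : wordExp (J ∘ π) = wordExp J := by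
  rw [wordExp, wordExp]
  exact Equiv.sum_comp π (fun j => Finsupp.single (J j) 1)

omit [DecidableEq σ] in
/-- The monomial of a word is the product of its letters. [folklore] -/
theorem prod_X_eq_monomial_wordExp (J : Fin ℓ → σ) :
    (∏ j, X (J j) : MvPolynomial σ k) = monomial (wordExp J) 1 := by
  rw [wordExp, monomial_sum_index, C_1, one_mul]
  rfl

/-! ### The symmetric array of a form of degree `ℓ` -/

variable [Fintype σ]

omit [Field k] in
/-- The number of words with the same exponent vector as `J` (the multinomial coefficient of the
content of `J`). [folklore] -/
theorem card_filter_wordExp_pos (J : Fin ℓ → σ) :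
    0 < (Finset.univ.filter fun I : Fin ℓ → σ => wordExp I = wordExp J).card :=
  Finset.card_pos.mpr ⟨J, Finset.mem_filter.mpr ⟨Finset.mem_univ _, rfl⟩⟩

/-- **The symmetric array of a form.** For `q ∈ k[x_σ]`, the `ℓ`-dimensional array
`A(q)_J = coeff_{x_J}(q) / #{I : x_I = x_J}` indexed by words `J : Fin ℓ → σ` (the symmetric
tensor in `(V^*)^{⊗ℓ}` whose symmetrisation is the degree-`ℓ` part of `q`: `q = ∑_J A(q)_J x_J`,
`sum_arrOf_mul_prod_X`; requires the multinomial coefficients to be invertible, e.g.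
characteristic zero). BIP §3(a) (the pairing `Sym^d V × Sym^d V^*` and the tensor embedding).
[folklore] -/
noncomputable def arrOf (ℓ : ℕ) (q : MvPolynomial σ k) (J : Fin ℓ → σ) : k :=
  coeff (wordExp J) q / ((Finset.univ.filter fun I : Fin ℓ → σ => wordExp I = wordExp J).card : k)

/-- The array of a form is symmetric. [folklore] -/
theorem arrOf_comp_perm (q : MvPolynomial σ k) (J : Fin ℓ → σ) (π : Equiv.Perm (Fin ℓ)) :
    arrOf ℓ q (J ∘ π) = arrOf ℓ q J := by
  simp only [arrOf, wordExp_comp_perm]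

omit [Field k] [Fintype σ] in
/-- Every exponent vector of degree `ℓ` is the content of a word of length `ℓ`. [folklore] -/
theorem exists_wordExp_eq : ∀ {ℓ : ℕ} (e : σ →₀ ℕ), e.degree = ℓ → ∃ J : Fin ℓ → σ, wordExp J = e
  | 0, e, he => ⟨Fin.elim0, by
      rw [Finsupp.degree_eq_zero_iff] at he
      subst he
      simp [wordExp]⟩
  | ℓ + 1, e, he => by
    have he0 : e ≠ 0 := by
      rintro rfl
      simp at he
    obtain ⟨x, hx⟩ := Finsupp.support_nonempty_iff.mpr he0
    have hx1 : 1 ≤ e x := Nat.one_le_iff_ne_zero.mpr (Finsupp.mem_support_iff.mp hx)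
    set e' := e - Finsupp.single x 1 with he'
    have hee' : e = Finsupp.single x 1 + e' := by
      ext y
      simp only [he', Finsupp.coe_add, Pi.add_apply, Finsupp.coe_tsub, Pi.sub_apply,
        Finsupp.single_apply]
      split_ifs with h
      · subst h; omega
      · omega
    have hdeg : e'.degree = ℓ := by
      have h := congrArg Finsupp.degree hee'
      rw [map_add, Finsupp.degree_single, he] at h
      omega
    obtain ⟨J', hJ'⟩ := exists_wordExp_eq e' hdeg
    refine ⟨Fin.cons x J', ?_⟩
    rw [wordExp, Fin.sum_univ_succ, Fin.cons_zero, hee', ← hJ', wordExp]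
    simp

/-- The words with a given content of degree `ℓ` sum the monomial back:
`∑_{J : x_J = x^e} A(q)_J x_J = coeff_e(q) x^e` (characteristic zero). [folklore] -/
theorem sum_filter_arrOf_mul_prod_X [CharZero k] (q : MvPolynomial σ k) (J₀ : Fin ℓ → σ) :
    ∑ J ∈ Finset.univ.filter (fun J : Fin ℓ → σ => wordExp J = wordExp J₀),
      C (arrOf ℓ q J) * ∏ j, X (J j) = monomial (wordExp J₀) (coeff (wordExp J₀) q) := by
  classical
  have hterm : ∀ J ∈ Finset.univ.filter (fun J : Fin ℓ → σ => wordExp J = wordExp J₀),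
      C (arrOf ℓ q J) * ∏ j, X (J j) =
        monomial (wordExp J₀) (coeff (wordExp J₀) q /
          ((Finset.univ.filter fun I : Fin ℓ → σ => wordExp I = wordExp J₀).card : k)) := by
    intro J hJ
    have hJ' := (Finset.mem_filter.mp hJ).2
    rw [prod_X_eq_monomial_wordExp, C_mul_monomial, mul_one, arrOf, hJ']
  rw [Finset.sum_congr rfl hterm, Finset.sum_const, nsmul_eq_mul, ← C_eq_coe_nat, C_mul_monomial,
    mul_div_cancel₀ _ (Nat.cast_ne_zero.mpr (card_filter_wordExp_pos J₀).ne')]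

/-- **Symmetrisation**: a form of degree `ℓ` is the symmetrisation of its array,
`q = ∑_J A(q)_J · x_{J_0} ⋯ x_{J_{ℓ-1}}` (characteristic zero). BIP §3(a). [folklore] -/
theorem sum_arrOf_mul_prod_X [CharZero k] {q : MvPolynomial σ k} (hq : q.IsHomogeneous ℓ) :
    ∑ J : Fin ℓ → σ, C (arrOf ℓ q J) * ∏ j, X (J j) = q := by
  classical
  rw [← Finset.sum_fiberwise_of_maps_to (s := Finset.univ) (t := Finset.univ.image wordExp)
    (g := wordExp) (fun J _ => Finset.mem_image_of_mem _ (Finset.mem_univ J))]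
  have h1 : ∀ e ∈ (Finset.univ : Finset (Fin ℓ → σ)).image wordExp,
      ∑ J ∈ Finset.univ.filter (fun J : Fin ℓ → σ => wordExp J = e), C (arrOf ℓ q J) * ∏ j, X (J j) =
        monomial e (coeff e q) := by
    intro e he
    obtain ⟨J₀, -, rfl⟩ := Finset.mem_image.mp he
    exact sum_filter_arrOf_mul_prod_X q J₀
  rw [Finset.sum_congr rfl h1]
  conv_rhs => rw [← q.support_sum_monomial_coeff]
  symm
  refine Finset.sum_subset (fun e he => ?_) (fun e _ he => ?_)
  · obtain ⟨J, hJ⟩ := exists_wordExp_eq (ℓ := ℓ) e (by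
      rw [Finsupp.degree_eq_weight_one]
      exact hq (mem_support_iff.mp he))
    exact Finset.mem_image.mpr ⟨J, Finset.mem_univ _, hJ⟩
  · rw [notMem_support_iff.mp he, monomial_zero]

/-- **The array of a symmetrisation**: for a symmetric array `A'`, the array of
`∑_I A'_I x_I` is `A'` (characteristic zero). [folklore] -/
theorem arrOf_sum_C_mul_prod_X [CharZero k] {A' : (Fin ℓ → σ) → k}
    (hA' : ∀ (I : Fin ℓ → σ) (π : Equiv.Perm (Fin ℓ)), A' (I ∘ π) = A' I) (J : Fin ℓ → σ) :
    arrOf ℓ (∑ I : Fin ℓ → σ, C (A' I) * ∏ j, X (I j)) J = A' J := by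
  classical
  rw [arrOf, coeff_sum]
  simp only [prod_X_eq_monomial_wordExp, C_mul_monomial, mul_one, coeff_monomial]
  rw [Finset.sum_ite, Finset.sum_const_zero, add_zero]
  have h1 : ∀ I ∈ Finset.univ.filter (fun I : Fin ℓ → σ => wordExp I = wordExp J), A' I = A' J := by
    intro I hI
    obtain ⟨π, rfl⟩ := exists_comp_perm_eq_of_wordExp_eq (Finset.mem_filter.mp hI).2
    rw [hA']
  rw [Finset.sum_congr rfl h1, Finset.sum_const, nsmul_eq_mul,
    mul_div_cancel_left₀ _ (Nat.cast_ne_zero.mpr (card_filter_wordExp_pos J).ne')]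

/-- **Transformation law of the array under linear substitution** (`X_i ↦ ∑_x B_{x i} X_x`):
`A(B · q)_I = ∑_J (∏_r B_{I_r J_r}) A(q)_J` — the array of a form is a (symmetric) tensor.
BIP §3(a) / §4 (tensor contraction). [folklore] -/
theorem arrOf_linSubst [CharZero k] (B : Matrix σ σ k) {q : MvPolynomial σ k}
    (hq : q.IsHomogeneous ℓ) (I : Fin ℓ → σ) :
    arrOf ℓ (linSubst σ k B q) I = ∑ J : Fin ℓ → σ, (∏ r, B (I r) (J r)) * arrOf ℓ q J := by
  classical
  -- expand `B · q = ∑_I (∑_J (∏_r B_{I_r J_r}) A(q)_J) x_I`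
  have hexp : linSubst σ k B q =
      ∑ I : Fin ℓ → σ, C (∑ J : Fin ℓ → σ, (∏ r, B (I r) (J r)) * arrOf ℓ q J) * ∏ j, X (I j) := by
    conv_lhs => rw [← sum_arrOf_mul_prod_X hq, map_sum]
    simp only [map_mul, linSubst_C, map_prod, linSubst_X]
    -- `∏_j (∑_x B_{x, J j} X_x) = ∑_I ∏_j B_{I_j, J_j} X_{I_j}`
    have hprod : ∀ J : Fin ℓ → σ, (∏ j, ∑ x, B x (J j) • (X x : MvPolynomial σ k)) =
        ∑ I : Fin ℓ → σ, ∏ j, B (I j) (J j) • (X (I j) : MvPolynomial σ k) := fun J =>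
      Finset.prod_univ_sum (fun _ => Finset.univ) fun j x => B x (J j) • (X x : MvPolynomial σ k)
    simp only [hprod, Finset.mul_sum, map_sum, Finset.sum_mul]
    rw [Finset.sum_comm]
    refine Finset.sum_congr rfl fun I _ => Finset.sum_congr rfl fun J _ => ?_
    simp only [smul_eq_C_mul, map_mul, map_prod, Finset.prod_mul_distrib]
    ring
  rw [hexp, arrOf_sum_C_mul_prod_X]
  -- the new array is symmetric
  intro I' π
  conv_lhs => rw [← Equiv.sum_comp (π.symm.arrowCongr (Equiv.refl σ))]
  refine Finset.sum_congr rfl fun J _ => ?_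
  have hJ : (π.symm.arrowCongr (Equiv.refl σ)) J = J ∘ π := by
    funext r; simp [Equiv.arrowCongr_apply]
  rw [hJ, arrOf_comp_perm]
  congr 1
  exact Equiv.prod_comp π (fun r => B (I' r) (J r))


/-! ### Restriction to an upper set of indices -/

section TopRestrict

variable {kk : ℕ}

/-- **Upper triangular substitutions do not mix in lower indices**: if `B_{x y} = 0` for `y < x`
(upper triangular in the column convention `X_i ↦ ∑_x B_{x i} X_x`) and `t : Fin kk → σ` enumerates
an upper set of indices, then the array of `B · q` on words in `t` only involves the array of `q`
on words in `t`, through the `kk × kk` block `B_{t a, t b}`: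
`A(B·q)_{t∘I} = ∑_{J} (∏_r B_{t I_r, t J_r}) A(q)_{t∘J}`. This is the key step of BIP Thm. 4.9 /
Lemma 5.3-type arguments ("upper triangular matrices only raise indices"). [folklore] -/
theorem arrOf_linSubst_comp_of_upper [CharZero k] [LinearOrder σ] {B : Matrix σ σ k}
    (hB : ∀ x y, y < x → B x y = 0) {t : Fin kk → σ} (ht : Function.Injective t)
    (hup : ∀ a x, t a ≤ x → ∃ b, t b = x) {q : MvPolynomial σ k} (hq : q.IsHomogeneous ℓ)
    (I : Fin ℓ → Fin kk) :
    arrOf ℓ (linSubst σ k B q) (t ∘ I) =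
      ∑ J : Fin ℓ → Fin kk, (∏ r, B (t (I r)) (t (J r))) * arrOf ℓ q (t ∘ J) := by
  classical
  rw [arrOf_linSubst B hq]
  -- words not in the image of `t ∘ ·` contribute zero
  have hemb : Function.Injective (fun J : Fin ℓ → Fin kk => t ∘ J) := fun J J' h =>
    funext fun r => ht (congrFun h r)
  have hmap : ∑ J : Fin ℓ → Fin kk, (∏ r, B (t (I r)) (t (J r))) * arrOf ℓ q (t ∘ J) =
      ∑ J ∈ (Finset.univ : Finset (Fin ℓ → Fin kk)).map ⟨_, hemb⟩,
        (∏ r, B ((t ∘ I) r) (J r)) * arrOf ℓ q J := by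
    rw [Finset.sum_map]
    rfl
  rw [hmap]
  refine (Finset.sum_subset (Finset.subset_univ _) fun J _ hJ => ?_).symm
  -- some letter of `J` lies outside the image of `t`, hence strictly below `t (I r)`
  obtain ⟨r, hr⟩ : ∃ r, ∀ b, t b ≠ J r := by
    by_contra hcon
    push Not at hcon
    choose J' hJ' using hcon
    exact hJ (Finset.mem_map.mpr ⟨J', Finset.mem_univ _, funext hJ'⟩)
  have hlt : J r < t (I r) := by
    by_contra hle
    obtain ⟨b, hb⟩ := hup (I r) (J r) (not_lt.mp hle)
    exact hr b hb
  rw [Finset.prod_eq_zero (Finset.mem_univ r) (hB _ _ hlt), zero_mul]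

end TopRestrict


/-! ### The hyperdeterminant as a polynomial function on `Sym^ℓ V^*`, and its highest-weight
property -/

section HyperdetPoly

variable {kk : ℕ}

omit [Field k] [DecidableEq σ] [Fintype σ] in
/-- Ring homomorphisms commute with the hyperdeterminant (a polynomial expression in the entries).
[folklore] -/
theorem map_hyperdet {R S : Type*} [CommRing R] [CommRing S] (f : R →+* S)
    (A : (Fin ℓ → Fin kk) → R) : f (hyperdet A) = hyperdet fun J => f (A J) := by
  unfold hyperdet
  simp [map_sum, map_mul, map_prod]

/-- The degree-`ℓ` index of a word in the letters `t`. [folklore] -/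
noncomputable def wordDegIdx (t : Fin kk → σ) (J : Fin ℓ → Fin kk) : DegIdx σ ℓ :=
  ⟨wordExp (t ∘ J), mem_degMonomials_iff.mpr (degree_wordExp _)⟩

/-- **The hyperdeterminant polynomial** on `Sym^ℓ V^*` attached to `kk` letters `t`: the
hyperdeterminant of the generic symmetric array `J ↦ X_{x_{t∘J}} / #{I : x_I = x_{t∘J}}`, an element
of `k[Sym^ℓ] = MvPolynomial (DegIdx σ ℓ) k`, homogeneous of degree `kk`, whose value at a form `q` is
`Det` of the array of `q` on words in `t` (`aeval_formCoeff_hyperdetPoly`). For `ℓ` even and `t` the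
top `kk` indices this is (the dual form of) BIP's highest-weight vector `v_T` of weight `kk × ℓ`
(Cor. 4.8) in `Sym^{kk} Sym^ℓ V`. [cite: BurgisserIkenmeyerPanovaJAMS2019, Cor. 4.8] -/
noncomputable def hyperdetPoly (ℓ : ℕ) (t : Fin kk → σ) : MvPolynomial (DegIdx σ ℓ) k :=
  hyperdet fun J : Fin ℓ → Fin kk =>
    C (((Finset.univ.filter fun I : Fin ℓ → σ => wordExp I = wordExp (t ∘ J)).card : k)⁻¹) *
      X (wordDegIdx t J)

/-- Evaluating the hyperdeterminant polynomial at a point `w` of `Sym^ℓ V^*`. [folklore] -/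
theorem aeval_hyperdetPoly (t : Fin kk → σ) (w : DegIdx σ ℓ → k) :
    aeval w (hyperdetPoly ℓ t : MvPolynomial (DegIdx σ ℓ) k) = hyperdet fun J : Fin ℓ → Fin kk =>
      (((Finset.univ.filter fun I : Fin ℓ → σ => wordExp I = wordExp (t ∘ J)).card : k))⁻¹ *
        w (wordDegIdx t J) := by
  rw [hyperdetPoly, show (aeval w : MvPolynomial (DegIdx σ ℓ) k →ₐ[k] k) (hyperdet _) =
    (aeval w : MvPolynomial (DegIdx σ ℓ) k →ₐ[k] k).toRingHom (hyperdet _) from rfl, map_hyperdet]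
  congr 1
  funext J
  change aeval w (C _ * X _) = _
  rw [map_mul, aeval_C, aeval_X, Algebra.algebraMap_self_apply]

/-- **The hyperdeterminant polynomial evaluates to the hyperdeterminant of the array of the form.**
[cite: BurgisserIkenmeyerPanovaJAMS2019, Cor. 4.8] -/
theorem aeval_formCoeff_hyperdetPoly (t : Fin kk → σ) (q : MvPolynomial σ k) :
    aeval (formCoeff ℓ q) (hyperdetPoly ℓ t : MvPolynomial (DegIdx σ ℓ) k) =
      hyperdet fun J : Fin ℓ → Fin kk => arrOf ℓ q (t ∘ J) := by
  rw [aeval_hyperdetPoly]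
  congr 1
  funext J
  rw [formCoeff_apply, arrOf, div_eq_inv_mul]
  rfl

/-- **Relative invariance under upper triangular substitutions**: for `B` upper triangular and
`t` a strictly increasing enumeration of an upper set of indices,
`HD(B · q) = (∏_a B_{t a, t a})^ℓ · HD(q)`. [folklore] -/
theorem aeval_formCoeff_linSubst_hyperdetPoly [CharZero k] [LinearOrder σ] {B : Matrix σ σ k}
    (hB : ∀ x y, y < x → B x y = 0) {t : Fin kk → σ} (hmono : StrictMono t)
    (hup : ∀ a x, t a ≤ x → ∃ b, t b = x) {q : MvPolynomial σ k} (hq : q.IsHomogeneous ℓ) :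
    aeval (formCoeff ℓ (linSubst σ k B q)) (hyperdetPoly ℓ t : MvPolynomial (DegIdx σ ℓ) k) =
      (∏ a, B (t a) (t a)) ^ ℓ * aeval (formCoeff ℓ q) (hyperdetPoly ℓ t : MvPolynomial (DegIdx σ ℓ) k) := by
  classical
  rw [aeval_formCoeff_hyperdetPoly, aeval_formCoeff_hyperdetPoly]
  have harr : (fun I : Fin ℓ → Fin kk => arrOf ℓ (linSubst σ k B q) (t ∘ I)) = fun I =>
      ∑ J : Fin ℓ → Fin kk, (∏ r, (Matrix.of fun a b => B (t a) (t b)) (I r) (J r)) *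
        arrOf ℓ q (t ∘ J) := by
    funext I
    rw [arrOf_linSubst_comp_of_upper hB hmono.injective hup hq]
    rfl
  rw [harr, hyperdet_tensorMul, Matrix.det_of_upperTriangular]
  · rfl
  · intro a b hba
    exact hB _ _ (hmono hba)

/-- Every point of `Sym^ℓ V^*` is the coefficient vector of a form of degree `ℓ`. [folklore] -/
theorem exists_formCoeff_eq (w : DegIdx σ ℓ → k) :
    ∃ q : MvPolynomial σ k, q.IsHomogeneous ℓ ∧ formCoeff ℓ q = w := by
  classical
  refine ⟨∑ e : DegIdx σ ℓ, w e • monomial e.1 (1 : k), ?_, ?_⟩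
  · exact IsHomogeneous.sum _ _ _ fun e _ => by
      rw [smul_monomial, smul_eq_mul, mul_one]
      exact isHomogeneous_monomial _ (mem_degMonomials_iff.mp e.2)
  · funext d
    rw [formCoeff_apply, coeff_sum]
    simp only [coeff_smul, coeff_monomial, smul_eq_mul, mul_ite, mul_one, mul_zero]
    rw [Finset.sum_eq_single d]
    · rw [if_pos rfl]
    · intro e _ hne
      rw [if_neg (fun h => hne (Subtype.ext h))]
    · exact fun h => absurd (Finset.mem_univ d) h

end HyperdetPoly


end Words

/-! ### The hyperdeterminant polynomial is a highest-weight vector -/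

section HyperdetHW

variable {kk : ℕ} [Fintype σ] [LinearOrder σ]

/-- The weight `-ℓ` on the letters `t`, `0` elsewhere: the dual weight of the rectangle
`kk × ℓ` placed on the top `kk` indices (when `t` enumerates them). [folklore] -/
def rectWeight (ℓ : ℕ) (t : Fin kk → σ) : Literature.NumberTheory.DiophantineGeometry.Weight σ :=
  fun x => if x ∈ Set.range t then -(ℓ : ℤ) else 0

/-- The weight character of `rectWeight` on an upper triangular `b` is `∏_a b_{t a, t a}^{-ℓ}`.
[folklore] -/
theorem weightChar_rectWeight {t : Fin kk → σ} (ht : Function.Injective t) (b : GL σ k) :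
    Literature.NumberTheory.DiophantineGeometry.weightChar (rectWeight ℓ t) b = ∏ a, ((b : Matrix σ σ k) (t a) (t a) ^ (ℓ : ℤ))⁻¹ := by
  classical
  rw [Literature.NumberTheory.DiophantineGeometry.weightChar]
  have hsplit : ∏ x, (b : Matrix σ σ k) x x ^ rectWeight ℓ t x =
      ∏ x ∈ Finset.univ.image t, (b : Matrix σ σ k) x x ^ rectWeight ℓ t x := by
    refine (Finset.prod_subset (Finset.subset_univ _) fun x _ hx => ?_).symm
    rw [rectWeight, if_neg, zpow_zero]
    rintro ⟨a, rfl⟩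
    exact hx (Finset.mem_image_of_mem t (Finset.mem_univ a))
  rw [hsplit, Finset.prod_image fun a _ b _ h => ht h]
  refine Finset.prod_congr rfl fun a _ => ?_
  rw [rectWeight, if_pos ⟨a, rfl⟩, zpow_neg]

/-- **The hyperdeterminant polynomial is a highest-weight vector of `k[Sym^ℓ]`** of weight
`rectWeight ℓ t` (`-ℓ` on the top `kk` indices enumerated increasingly by `t`), over a field of
characteristic zero: for upper triangular `b`,
`(b · HD)(q) = HD(b⁻¹ · q) = (∏_a (b⁻¹)_{t a t a})^ℓ HD(q) = χ(b) HD(q)`, and polynomial functions on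
`Sym^ℓ V^*` are determined by their values. BIP Cor. 4.8 (dual form).
[cite: BurgisserIkenmeyerPanovaJAMS2019, Cor. 4.8] -/
theorem hyperdetPoly_mem_highestWeightSpace [CharZero k] {t : Fin kk → σ} (hmono : StrictMono t)
    (hup : ∀ a x, t a ≤ x → ∃ b, t b = x) :
    (hyperdetPoly ℓ t : MvPolynomial (DegIdx σ ℓ) k) ∈
      Literature.NumberTheory.DiophantineGeometry.highestWeightSpace (coordRep σ k ℓ) (rectWeight ℓ t) := by
  classical
  intro b hb
  apply MvPolynomial.funext
  intro w
  obtain ⟨q, hq, rfl⟩ := exists_formCoeff_eq w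
  change aeval (formCoeff ℓ q) (coordSubst ℓ b (hyperdetPoly ℓ t)) =
    aeval (formCoeff ℓ q) (Literature.NumberTheory.DiophantineGeometry.weightChar (rectWeight ℓ t) b • hyperdetPoly ℓ t)
  have hb' : Literature.NumberTheory.DiophantineGeometry.IsUpperTriangular b⁻¹ := (Literature.NumberTheory.DiophantineGeometry.borelSubgroup σ k).inv_mem hb
  rw [aeval_formCoeff_coordSubst, linSubstRep_apply,
    aeval_formCoeff_linSubst_hyperdetPoly (fun x y hyx => hb'.apply_eq_zero hyx) hmono hup hq,
    map_smul, smul_eq_mul, weightChar_rectWeight hmono.injective]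
  congr 1
  rw [← Finset.prod_pow]
  refine Finset.prod_congr rfl fun a _ => ?_
  rw [inv_apply_diag_of_isUpperTriangular' hb, zpow_natCast, inv_pow]

end HyperdetHW


/-! ### Degree, and the value at a (rescaled) power sum of the letters -/

section HyperdetEval

variable {kk : ℕ} [Fintype σ] [LinearOrder σ]

/-- The hyperdeterminant polynomial is a form of degree `kk` on `k[Sym^ℓ]` (BIP: `v_T ∈ Sym^k Sym^ℓ V`
for the tableau of shape `k × ℓ`). [cite: BurgisserIkenmeyerPanovaJAMS2019, Cor. 4.8] -/
theorem isHomogeneous_hyperdetPoly (t : Fin kk → σ) :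
    (hyperdetPoly ℓ t : MvPolynomial (DegIdx σ ℓ) k).IsHomogeneous kk := by
  classical
  unfold hyperdetPoly hyperdet
  refine IsHomogeneous.sum _ _ _ fun τ _ => ?_
  have h1 : ∀ i : Fin kk, ((C (((Finset.univ.filter fun I : Fin ℓ → σ =>
      wordExp I = wordExp (t ∘ fun j => τ j i)).card : k)⁻¹) * X (wordDegIdx t fun j => τ j i)) :
        MvPolynomial (DegIdx σ ℓ) k).IsHomogeneous 1 := fun i => by
    have h := (isHomogeneous_C (DegIdx σ ℓ) ((((Finset.univ.filter fun I : Fin ℓ → σ =>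
      wordExp I = wordExp (t ∘ fun j => τ j i)).card : k))⁻¹)).mul
      (isHomogeneous_X k (wordDegIdx t fun j => τ j i))
    rwa [zero_add] at h
  have h2 := IsHomogeneous.prod Finset.univ _ (fun _ => 1) fun i _ => h1 i
  rw [Finset.sum_const, Finset.card_univ, Fintype.card_fin, smul_eq_mul, mul_one] at h2
  have h3 := (isHomogeneous_C (DegIdx σ ℓ) (∏ j, (Equiv.Perm.sign (τ j) : k))).mul h2
  rw [zero_add] at h3
  convert h3 using 2
  rw [map_prod]
  simp

omit [Fintype σ] in
/-- A word has the content of `x^ℓ` iff it is the constant word `x` (`ℓ` letters). [folklore] -/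
theorem wordExp_eq_single_iff {J : Fin ℓ → σ} {x : σ} :
    wordExp J = Finsupp.single x ℓ ↔ ∀ j, J j = x := by
  classical
  constructor
  · intro h j
    by_contra hj
    have h1 := congrArg (fun e => e (J j)) h
    simp only [wordExp_apply, Finsupp.single_apply, if_neg (Ne.symm hj)] at h1
    have : j ∈ Finset.univ.filter (fun j' => J j' = J j) := Finset.mem_filter.mpr ⟨Finset.mem_univ _, rfl⟩
    rw [Finset.card_eq_zero.mp h1] at this
    exact Finset.notMem_empty _ this
  · intro h
    have hJ : J = fun _ => x := funext h
    subst hJ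
    rw [wordExp, Finset.sum_const, Finset.card_univ, Fintype.card_fin, Finsupp.smul_single,
      smul_eq_mul, mul_one]

/-- The fibre of a constant word is a singleton. [folklore] -/
theorem card_filter_wordExp_const (x : σ) :
    (Finset.univ.filter fun I : Fin ℓ → σ => wordExp I = wordExp (fun _ : Fin ℓ => x)).card = 1 := by
  classical
  rw [Finset.card_eq_one]
  refine ⟨fun _ => x, Finset.ext fun I => ?_⟩
  rw [Finset.mem_filter, Finset.mem_singleton, (wordExp_eq_single_iff (J := fun _ : Fin ℓ => x)).mpr
    (fun _ => rfl), wordExp_eq_single_iff]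
  exact ⟨fun h => funext h.2, fun h => ⟨Finset.mem_univ _, congrFun h⟩⟩

omit [Fintype σ] in
/-- The coefficients of the power sum of the letters: `coeff_e (∑_a x_{t a}^ℓ) = [e = ℓ ε_{t a} for some a]`.
[folklore] -/
theorem coeff_wordExp_sum_X_pow {t : Fin kk → σ} (ht : Function.Injective t) (hℓ : 0 < ℓ)
    (J : Fin ℓ → Fin kk) :
    coeff (wordExp (t ∘ J)) (∑ a, X (t a) ^ ℓ : MvPolynomial σ k) =
      if ∀ j, J j = J ⟨0, hℓ⟩ then 1 else 0 := by
  classical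
  rw [coeff_sum]
  simp only [coeff_X_pow]
  by_cases hJ : ∀ j, J j = J ⟨0, hℓ⟩
  · rw [if_pos hJ, Finset.sum_eq_single (J ⟨0, hℓ⟩)]
    · rw [if_pos]
      exact ((wordExp_eq_single_iff (J := t ∘ J)).mpr fun j => congrArg t (hJ j)).symm
    · intro a _ ha
      rw [if_neg]
      intro h
      have := (wordExp_eq_single_iff (J := t ∘ J)).mp h.symm ⟨0, hℓ⟩
      exact ha (ht this).symm
    · exact fun h => absurd (Finset.mem_univ _) h
  · rw [if_neg hJ]
    refine Finset.sum_eq_zero fun a _ => if_neg fun h => hJ fun j => ?_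
    have h1 := (wordExp_eq_single_iff (J := t ∘ J)).mp h.symm
    exact ht ((h1 j).trans (h1 ⟨0, hℓ⟩).symm)

/-- **The hyperdeterminant polynomial at a rescaled power sum of the letters**: for nonzero
scalars `c_e` and `p = ∑_a x_{t a}^ℓ` (`ℓ ≥ 1` even), the value of `HD` at the point
`e ↦ c_e · coeff_e(p)` is `kk! ∏_a c_{ℓ ε_{t a}}` (the array is diagonal, `hyperdet_diagArr`). This
is BIP Cor. 4.8 ("`⟨v_T, (a X_1^ℓ + b X_2^ℓ + ⋯ + b X_k^ℓ)^k⟩ ≠ 0`") in dual form.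
[cite: BurgisserIkenmeyerPanovaJAMS2019, Cor. 4.8] -/
theorem aeval_hyperdetPoly_scaled_powerSum {t : Fin kk → σ} (ht : Function.Injective t) (hℓ : 0 < ℓ)
    (he : Even ℓ) (c : DegIdx σ ℓ → k) :
    aeval (fun e : DegIdx σ ℓ => c e * formCoeff ℓ (∑ a, X (t a) ^ ℓ : MvPolynomial σ k) e)
      (hyperdetPoly ℓ t : MvPolynomial (DegIdx σ ℓ) k) =
      (Nat.factorial kk : k) * ∏ a, c (wordDegIdx t fun _ : Fin ℓ => a) := by
  classical
  rw [aeval_hyperdetPoly]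
  have harr : (fun J : Fin ℓ → Fin kk =>
      (((Finset.univ.filter fun I : Fin ℓ → σ => wordExp I = wordExp (t ∘ J)).card : k))⁻¹ *
        (c (wordDegIdx t J) * formCoeff ℓ (∑ a, X (t a) ^ ℓ : MvPolynomial σ k) (wordDegIdx t J))) =
      diagArr fun a => c (wordDegIdx t fun _ : Fin ℓ => a) := by
    funext J
    rw [formCoeff_apply]
    change _ * (c (wordDegIdx t J) * coeff (wordExp (t ∘ J)) _) = _
    rw [coeff_wordExp_sum_X_pow ht hℓ]
    by_cases hJ : ∀ j, J j = J ⟨0, hℓ⟩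
    · have hJ' : J = fun _ => J ⟨0, hℓ⟩ := funext hJ
      rw [if_pos hJ, mul_one, hJ', diagArr_const hℓ]
      rw [show (t ∘ fun _ : Fin ℓ => J ⟨0, hℓ⟩) = fun _ => t (J ⟨0, hℓ⟩) from rfl,
        card_filter_wordExp_const, Nat.cast_one, inv_one, one_mul]
    · obtain ⟨j, hj⟩ := not_forall.mp hJ
      rw [if_neg hJ, mul_zero, mul_zero, diagArr_of_ne _ (j := j) (j' := ⟨0, hℓ⟩) hj]
  rw [harr, hyperdet_diagArr hℓ he]

end HyperdetEval

end Literature.Computability.AlgebraicComplexity
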